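import Summits.QuantumFields.YangMills.Theorems.FemtoTransferGapBlockToFine
import Summits.QuantumFields.YangMills.Theorems.FemtoTransferGapLevelsDecay
import Summits.QuantumFields.YangMills.Theorems.DressedRitz.Negative.DressedMixtureHazard
import HarnessLib

/-!
# Route `LuscherReduction`, crux `DressedRitz` (stmt-QuantumFields-20205), line «polyakovlift» r8 — NEGATIVE lane:
# BOTH block-defect hypotheses of the block-to-fine door `BlockToFine.defect_contraction` are load-bearing

Negative-side support lemmas of the standing disprover (seat `ym-cdisprove-20205-1`, GEN 12; work file `Cruxes/DressedRitz/Disproof.lean` §16).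
Nothing here asserts a route item; nothing here refutes one.

TRIGGER.  The lead (ym-lead-20205-polyakovlift g4) adopted the crux idea «block-endpoint» for skeleton r8 (`7611d10d84d95233`, RG stubs
`stub_liftStatics ∕ stub_universality ∕ stub_liftLeakage` over `TransplantBasisLR k`) and LANDED the door
`FemtoTransferGap.BlockToFine.defect_contraction` (p586508): for a physical `v`, block length `ℓ ≥ 1`, `u = K^ℓ v`, and `0 ≤ δ ≤ 1/32`,
  (H1, RAW block defect)      `⟨v,K^{2ℓ}v⟩·⟨v,v⟩ ≤ (1+δ)·⟨v,K^ℓ v⟩²`,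
  (H2, DRESSED block defect)  `⟨u,K^{2ℓ}u⟩·⟨u,u⟩ ≤ (1+δ)·⟨u,K^ℓ u⟩²`
  ⟹ (c) `‖Ku‖²·‖u‖² − ⟨u,Ku⟩² ≤ (600δ/ℓ²)·⟨u,Ku⟩²`,
so that the `1/L²`-precision fine clause S-LEAK (`LeakageForL`, `ℓ = dressSteps L = L`) is to follow from block-aligned data at `L`-FREE precision
(announced companion `…PolyakovLiftBlockLeakage.lean : LeakageForL P ⟸ BlockLeakageForL P`, r9 to come).

THE POINT (kernel-checked, in the tree's own currency — exact physical eigenvectors of `K_β` on the `L = 1` lattice at `β = 1`):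
* ★ `defect_contraction_false_without_raw` (§4): drop (H1) and NO constant `c₀` (in place of `600`) saves (c): the DOWNWARD two-level atom
  `v = ψ₁ + ψ₂` (`κ₂ ≤ κ₁/2`) has dressed block defect `≤ δ := (κ₂/κ₁)^{2ℓ}` but fine defect `≍ δ·(κ₁−κ₂)²/κ₁²·⟨u,Ku⟩²` with NO `1/ℓ²` — the best
  constant is `≥ ℓ²/16`.  Read at `ℓ = L`: a block stub that constrains only the DRESSED family `dressedLiftFamily` (all four r8 `…ForL` texts speak of
  `dressedLiftFamily` alone) feeds the door with an effective constant `∝ L²`, i.e. the `1/L²` gain is lost and one is back at S-LEAK's own precision.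
* ★ `defect_contraction_false_without_dressed` (§5): drop (H2) and NO constant saves (c), already at `ℓ = 1`: the UPWARD atom
  `v = ψ₂ + r²•ψ₁` (`r = κ₂/κ₁` small; weight `r⁴` on the HIGHER level) has raw block defect `≤ r²` but fine defect of RELATIVE size `(1−r)²/(r²(1+r)²) → ∞`
  against `⟨u,Ku⟩²` (card «block-endpoint», falsifier F2, kernel form).  In the transplant family the upward atoms are the lower members `j < i` of the
  same multiplet ladder and the stiff admixtures seen from BELOW; the vacuum itself is excluded by `OpPlat.ins`.
* r9 DESIGN CONSEQUENCE (for the lead's `BlockLeakageForL`): the block text must carry BOTH clauses — the raw-lift clause on `liftFamily β φ g`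
  (block times `0, L, 2L`) AND the dressed-lift clause on `dressedLiftFamily β φ g` (block times `2L, 3L, 4L`) — with the SAME `L`-free `δ = Cλ³ ≤ 1/32`
  (the latter forces a `lam0`); neither half alone reaches (o4) through the door.  §1–§2 supply the two-level block data and the far eigenpair used, §3 the
  pure-real arithmetic of the two atoms.

HONEST FRAMING: fixed-lattice linear algebra (`L = 1`, `β = 1`, exact eigenvectors from `exists_isPhys_eigenfamily_of_pos` and the decay
`tendsto_levelValue_atTop_zero`) about the HYPOTHESES of a door lemma of a child of the CONDITIONAL reduction route R2b1; no stub is closed or refuted;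
nothing here bears on infinite volume, the continuum limit or the Clay mass gap.  [folklore]; spectral calculus as in Reed–Simon IV, Thm. XIII.1
[cite: ReedSimonIV1978, Thm. XIII.1]; block-time effective masses: M. Lüscher, U. Wolff, NPB 339 (1990) 222 [cite: LuscherWolff1990].
-/

set_option autoImplicit false

noncomputable section

open MeasureTheory Filter Topology Real
open Literature.MathematicalPhysics.QuantumFieldTheory (GaugeConfig Site gaugeTransform)
open scoped BigOperators

namespace Summit.QuantumFields.YangMills.Theorems.FemtoTransferGap.PolyakovLift.Negative

open Summit.QuantumFields.YangMills.Theorems.FemtoTransferGap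
open Summit.QuantumFields.YangMills.Theorems.FemtoTransferGap.PolyakovLift

/-! ## §1 Two-level BLOCK data of the dressed mixture -/

section TwoLevel

variable {L : ℕ} [NeZero L] (β : ℝ) {ψ₁ ψ₂ : GaugeConfig 3 L SU2 → ℝ} {κ₁ κ₂ : ℝ}

/-- Mixed block pairing of the two-level mixture: `⟨K^[m](ψ₁ + s•ψ₂), K^[n](ψ₁ + s•ψ₂)⟩ = κ₁^{m+n} + s²κ₂^{m+n}`. [folklore] -/
theorem l2_mixture_iterate_iterate (h₁ : IsPhys ψ₁) (h₂ : IsPhys ψ₂)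
    (he₁ : transferApply β ψ₁ = κ₁ • ψ₁) (he₂ : transferApply β ψ₂ = κ₂ • ψ₂)
    (hn₁ : l2 ψ₁ ψ₁ = 1) (hn₂ : l2 ψ₂ ψ₂ = 1) (h₁₂ : l2 ψ₁ ψ₂ = 0) (s : ℝ) (m n : ℕ) :
    l2 ((transferApply (L := L) β)^[m] (ψ₁ + s • ψ₂)) ((transferApply β)^[n] (ψ₁ + s • ψ₂)) =
      κ₁ ^ (m + n) + s ^ 2 * κ₂ ^ (m + n) := by
  rw [iterate_transferApply_mixture β h₁ h₂ he₁ he₂ s m, iterate_transferApply_mixture β h₁ h₂ he₁ he₂ s n,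
    l2_twoLevel_pair h₁ h₂ hn₁ hn₂ h₁₂]
  ring

/-- Raw block pairing of the two-level mixture: `⟨ψ₁ + s•ψ₂, K^[n](ψ₁ + s•ψ₂)⟩ = κ₁^n + s²κ₂^n`. [folklore] -/
theorem l2_mixture_self_iterate (h₁ : IsPhys ψ₁) (h₂ : IsPhys ψ₂)
    (he₁ : transferApply β ψ₁ = κ₁ • ψ₁) (he₂ : transferApply β ψ₂ = κ₂ • ψ₂)
    (hn₁ : l2 ψ₁ ψ₁ = 1) (hn₂ : l2 ψ₂ ψ₂ = 1) (h₁₂ : l2 ψ₁ ψ₂ = 0) (s : ℝ) (n : ℕ) :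
    l2 (ψ₁ + s • ψ₂) ((transferApply (L := L) β)^[n] (ψ₁ + s • ψ₂)) = κ₁ ^ n + s ^ 2 * κ₂ ^ n := by
  simpa using l2_mixture_iterate_iterate β h₁ h₂ he₁ he₂ hn₁ hn₂ h₁₂ s 0 n

/-- Gram number of the raw two-level mixture: `‖ψ₁ + s•ψ₂‖² = 1 + s²`. [folklore] -/
theorem l2_weightedMixture_self (h₁ : IsPhys ψ₁) (h₂ : IsPhys ψ₂)
    (he₁ : transferApply β ψ₁ = κ₁ • ψ₁) (he₂ : transferApply β ψ₂ = κ₂ • ψ₂)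
    (hn₁ : l2 ψ₁ ψ₁ = 1) (hn₂ : l2 ψ₂ ψ₂ = 1) (h₁₂ : l2 ψ₁ ψ₂ = 0) (s : ℝ) :
    l2 (ψ₁ + s • ψ₂) (ψ₁ + s • ψ₂) = 1 + s ^ 2 := by
  simpa using l2_mixture_iterate_iterate (L := L) β h₁ h₂ he₁ he₂ hn₁ hn₂ h₁₂ s 0 0

end TwoLevel

/-! ## §2 A far physical eigenpair: `0 < κ₂ ≤ ρκ₁`, any prescribed ratio `ρ ∈ (0,1)` -/

section FarPair

variable {L : ℕ} [NeZero L]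

/-- For `β > 0` and any `0 < ρ < 1` there are `l2`-orthonormal physical exact eigenvectors `ψ₁, ψ₂` of `K_β` with eigenvalues `κ₁ = λ₀ > 0` and
`0 < κ₂ ≤ ρκ₁` (the levels are positive and tend to `0`). [folklore] -/
theorem exists_eigenpair_ratio_le {β : ℝ} (hβ : 0 < β) {ρ : ℝ} (hρ : 0 < ρ) (hρ1 : ρ < 1) :
    ∃ (ψ₁ ψ₂ : GaugeConfig 3 L SU2 → ℝ) (κ₁ κ₂ : ℝ), IsPhys ψ₁ ∧ IsPhys ψ₂ ∧ l2 ψ₁ ψ₁ = 1 ∧ l2 ψ₂ ψ₂ = 1 ∧ l2 ψ₁ ψ₂ = 0 ∧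
      transferApply β ψ₁ = κ₁ • ψ₁ ∧ transferApply β ψ₂ = κ₂ • ψ₂ ∧ 0 < κ₁ ∧ 0 < κ₂ ∧ κ₂ ≤ ρ * κ₁ := by
  have h0 : 0 < levelValue su2Rep L β 0 := levelValue_su2Rep_pos hβ 0
  have hev := (tendsto_levelValue_atTop_zero (L := L) hβ).eventually
    (Iic_mem_nhds (show (0 : ℝ) < ρ * levelValue su2Rep L β 0 by positivity))
  obtain ⟨k, hk⟩ := hev.exists
  have hk' : levelValue su2Rep L β k ≤ ρ * levelValue su2Rep L β 0 := hk
  have hk0 : k ≠ 0 := by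
    rintro rfl
    have : levelValue su2Rep L β 0 ≤ ρ * levelValue su2Rep L β 0 := hk'
    nlinarith
  obtain ⟨e, he, hon, heig⟩ := exists_isPhys_eigenfamily_of_pos (L := L) hβ k
  have hne : (0 : Fin (k + 1)) ≠ Fin.last k := by
    intro h
    apply hk0
    have := congrArg Fin.val h
    simpa using this.symm
  refine ⟨e 0, e (Fin.last k), levelValue su2Rep L β 0, levelValue su2Rep L β k, he 0, he _, ?_, ?_, ?_, ?_, ?_, h0,
    levelValue_su2Rep_pos hβ k, hk'⟩
  · simpa using hon 0 0
  · simpa using hon (Fin.last k) (Fin.last k)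
  · simpa [hne] using hon 0 (Fin.last k)
  · simpa using heig 0
  · simpa using heig (Fin.last k)

end FarPair

/-! ## §3 Pure-real lemmas: the two atoms -/

section Arith

/-- Dressed block defect of the downward atom: `(X⁴+Y⁴)(X²+Y²) ≤ (1 + (Y/X)²)(X³+Y³)²` for `0 < Y ≤ X`
(`(X⁴+Y⁴)(X²+Y²) − (X³+Y³)² = X²Y²(X−Y)² ≤ X⁴Y²`). [folklore] -/
theorem dressedBlockDefect_downwardAtom {X Y : ℝ} (hX : 0 < X) (hY : 0 < Y) (hYX : Y ≤ X) :
    (X ^ 4 + Y ^ 4) * (X ^ 2 + Y ^ 2) ≤ (1 + (Y / X) ^ 2) * (X ^ 3 + Y ^ 3) ^ 2 := by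
  have key : (X ^ 4 + Y ^ 4) * (X ^ 2 + Y ^ 2) = (X ^ 3 + Y ^ 3) ^ 2 + X ^ 2 * Y ^ 2 * (X - Y) ^ 2 := by ring
  have hrhs : (1 + (Y / X) ^ 2) * (X ^ 3 + Y ^ 3) ^ 2 = (X ^ 3 + Y ^ 3) ^ 2 + Y ^ 2 * ((X ^ 3 + Y ^ 3) / X) ^ 2 := by ring
  have hsq1 : (X - Y) ^ 2 ≤ X ^ 2 := by nlinarith
  have hge : X ^ 2 ≤ (X ^ 3 + Y ^ 3) / X := by
    rw [le_div_iff₀ hX]; nlinarith [pow_pos hY 3]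
  have hsq2 : (X ^ 2) ^ 2 ≤ ((X ^ 3 + Y ^ 3) / X) ^ 2 := pow_le_pow_left₀ (by positivity) hge 2
  rw [key, hrhs]
  nlinarith [mul_le_mul_of_nonneg_left hsq1 (show 0 ≤ X ^ 2 * Y ^ 2 by positivity),
    mul_le_mul_of_nonneg_left hsq2 (show 0 ≤ Y ^ 2 by positivity)]

/-- The downward atom contradicts any `c₀/ℓ²` contraction once `ℓ > 8|c₀| + 8`: its fine defect is `X²Y²(κ₁−κ₂)² ≥ X²Y²κ₁²/4` while
`(Y/X)²(X²κ₁+Y²κ₂)² ≤ 4X²Y²κ₁²` (`X = κ₁^ℓ`, `Y = κ₂^ℓ`, `0 < Y ≤ X`, `κ₂ ≤ κ₁/2`). [folklore] -/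
theorem downwardAtom_contra {κ₁ κ₂ X Y c₀ : ℝ} {ℓ : ℕ} (hκ₁ : 0 < κ₁) (hκ₂ : 0 < κ₂) (hle : κ₂ ≤ κ₁ / 2)
    (hX : 0 < X) (hY : 0 < Y) (hYX : Y ≤ X) (hℓ : 8 * |c₀| + 8 < ℓ)
    (hc : (X ^ 2 * κ₁ ^ 2 + Y ^ 2 * κ₂ ^ 2) * (X ^ 2 + Y ^ 2) - (X ^ 2 * κ₁ + Y ^ 2 * κ₂) ^ 2 ≤
      c₀ * (Y / X) ^ 2 / (ℓ : ℝ) ^ 2 * (X ^ 2 * κ₁ + Y ^ 2 * κ₂) ^ 2) : False := by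
  have habs : 0 ≤ |c₀| := abs_nonneg c₀
  have hℓpos : (0 : ℝ) < (ℓ : ℝ) ^ 2 := by
    have : (0 : ℝ) < ℓ := by linarith
    positivity
  have hfine : (X ^ 2 * κ₁ ^ 2 + Y ^ 2 * κ₂ ^ 2) * (X ^ 2 + Y ^ 2) - (X ^ 2 * κ₁ + Y ^ 2 * κ₂) ^ 2 =
      X ^ 2 * Y ^ 2 * (κ₁ - κ₂) ^ 2 := by ring
  rw [hfine] at hc
  have hgap : κ₁ ^ 2 / 4 ≤ (κ₁ - κ₂) ^ 2 := by
    have h12 : κ₁ / 2 ≤ κ₁ - κ₂ := by linarith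
    calc κ₁ ^ 2 / 4 = (κ₁ / 2) ^ 2 := by ring
      _ ≤ (κ₁ - κ₂) ^ 2 := pow_le_pow_left₀ (by positivity) h12 2
  have hW : 0 < X ^ 2 * Y ^ 2 * κ₁ ^ 2 := by positivity
  have hlow : X ^ 2 * Y ^ 2 * κ₁ ^ 2 / 4 ≤ X ^ 2 * Y ^ 2 * (κ₁ - κ₂) ^ 2 := by
    have := mul_le_mul_of_nonneg_left hgap (show 0 ≤ X ^ 2 * Y ^ 2 by positivity)
    linarith
  have hQ : (Y / X) ^ 2 * (X ^ 2 * κ₁ + Y ^ 2 * κ₂) ^ 2 ≤ 4 * (X ^ 2 * Y ^ 2 * κ₁ ^ 2) := by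
    rw [div_pow, div_mul_eq_mul_div, div_le_iff₀ (by positivity)]
    have hY2 : Y ^ 2 ≤ X ^ 2 := pow_le_pow_left₀ hY.le hYX 2
    have hk : κ₂ ≤ κ₁ := by linarith
    have ht : Y ^ 2 * κ₂ ≤ X ^ 2 * κ₁ := mul_le_mul hY2 hk hκ₂.le (by positivity)
    have ht0 : 0 ≤ X ^ 2 * κ₁ + Y ^ 2 * κ₂ := by positivity
    have hsq : (X ^ 2 * κ₁ + Y ^ 2 * κ₂) ^ 2 ≤ (2 * (X ^ 2 * κ₁)) ^ 2 := pow_le_pow_left₀ ht0 (by linarith) 2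
    nlinarith [mul_le_mul_of_nonneg_left hsq (sq_nonneg Y)]
  rcases le_or_gt c₀ 0 with hc0 | hc0
  · -- c₀ ≤ 0: the right side is ≤ 0 < the fine defect
    have hr : c₀ * (Y / X) ^ 2 / (ℓ : ℝ) ^ 2 * (X ^ 2 * κ₁ + Y ^ 2 * κ₂) ^ 2 ≤ 0 := by
      have h0 : 0 ≤ (Y / X) ^ 2 / (ℓ : ℝ) ^ 2 * (X ^ 2 * κ₁ + Y ^ 2 * κ₂) ^ 2 := by positivity
      calc c₀ * (Y / X) ^ 2 / (ℓ : ℝ) ^ 2 * (X ^ 2 * κ₁ + Y ^ 2 * κ₂) ^ 2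
          = c₀ * ((Y / X) ^ 2 / (ℓ : ℝ) ^ 2 * (X ^ 2 * κ₁ + Y ^ 2 * κ₂) ^ 2) := by ring
        _ ≤ 0 := mul_nonpos_of_nonpos_of_nonneg hc0 h0
    linarith
  · -- c₀ > 0: ℓ² ≤ 16c₀, contradicting ℓ > 8|c₀| + 8
    have hr : c₀ * (Y / X) ^ 2 / (ℓ : ℝ) ^ 2 * (X ^ 2 * κ₁ + Y ^ 2 * κ₂) ^ 2 ≤
        c₀ / (ℓ : ℝ) ^ 2 * (4 * (X ^ 2 * Y ^ 2 * κ₁ ^ 2)) := by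
      calc c₀ * (Y / X) ^ 2 / (ℓ : ℝ) ^ 2 * (X ^ 2 * κ₁ + Y ^ 2 * κ₂) ^ 2
          = c₀ / (ℓ : ℝ) ^ 2 * ((Y / X) ^ 2 * (X ^ 2 * κ₁ + Y ^ 2 * κ₂) ^ 2) := by ring
        _ ≤ c₀ / (ℓ : ℝ) ^ 2 * (4 * (X ^ 2 * Y ^ 2 * κ₁ ^ 2)) := mul_le_mul_of_nonneg_left hQ (by positivity)
    have h1 : X ^ 2 * Y ^ 2 * κ₁ ^ 2 / 4 ≤ c₀ / (ℓ : ℝ) ^ 2 * (4 * (X ^ 2 * Y ^ 2 * κ₁ ^ 2)) := by linarith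
    -- divide by the positive weight: ℓ² ≤ 16 c₀
    have h2 : (ℓ : ℝ) ^ 2 ≤ 16 * c₀ := by
      rw [div_mul_eq_mul_div, le_div_iff₀ hℓpos] at h1
      by_contra hlt
      have hlt' : 16 * c₀ < (ℓ : ℝ) ^ 2 := not_le.mp hlt
      nlinarith [mul_lt_mul_of_pos_left hlt' hW]
    have hca : |c₀| = c₀ := abs_of_pos hc0
    rw [hca] at hℓ
    nlinarith [mul_lt_mul'' hℓ hℓ (by positivity) (by positivity)]

/-- Raw block defect of the upward atom at `ℓ = 1`: `(r²κ₁² + r⁴κ₁²)(1 + r⁴) ≤ (1 + r²)(rκ₁ + r⁴κ₁)²` for `0 < r ≤ 1`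
(stated in the exponent shape produced by the two-level lemmas at `n = 2·1, 1`). [folklore] -/
theorem rawBlockDefect_upwardAtom {κ₁ r : ℝ} (hκ₁ : 0 < κ₁) (hr : 0 < r) (hr1 : r ≤ 1) :
    ((r * κ₁) ^ (2 * 1) + (r ^ 2) ^ 2 * κ₁ ^ (2 * 1)) * (1 + (r ^ 2) ^ 2) ≤
      (1 + r ^ 2) * ((r * κ₁) ^ 1 + (r ^ 2) ^ 2 * κ₁ ^ 1) ^ 2 := by
  have h43 : r ^ 4 ≤ r ^ 3 := pow_le_pow_of_le_one hr.le hr1 (by norm_num)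
  have hcore : 1 + r ^ 4 ≤ (1 + r ^ 3) ^ 2 := by nlinarith [pow_pos hr 3, pow_pos hr 6]
  have hk : 0 ≤ κ₁ ^ 2 * r ^ 2 * (1 + r ^ 2) := by positivity
  have hmain := mul_le_mul_of_nonneg_left hcore hk
  calc ((r * κ₁) ^ (2 * 1) + (r ^ 2) ^ 2 * κ₁ ^ (2 * 1)) * (1 + (r ^ 2) ^ 2)
      = κ₁ ^ 2 * r ^ 2 * (1 + r ^ 2) * (1 + r ^ 4) := by ring
    _ ≤ κ₁ ^ 2 * r ^ 2 * (1 + r ^ 2) * (1 + r ^ 3) ^ 2 := hmain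
    _ = (1 + r ^ 2) * ((r * κ₁) ^ 1 + (r ^ 2) ^ 2 * κ₁ ^ 1) ^ 2 := by ring

/-- The upward atom contradicts any constant `c₀` at `ℓ = 1` once `r(|c₀|+1) ≤ 1/32`: its fine defect is `r⁶κ₁⁶(1−r)²` against
`c₀r²·⟨u,Ku⟩² = c₀r⁸κ₁⁶(1+r)²` (stated in the exponent shape produced by the two-level lemmas at `m = 1`; `t` is the cast `(1:ℕ)²`). [folklore] -/
theorem upwardAtom_contra {κ₁ r c₀ : ℝ} (hκ₁ : 0 < κ₁) (hr : 0 < r) (hrc : r * (|c₀| + 1) ≤ 1 / 32) (t : ℝ) (ht : t = 1)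
    (hc : (r ^ 2) ^ 2 * (r * κ₁ * κ₁) ^ (2 * 1) * (r * κ₁ - κ₁) ^ 2 ≤
      c₀ * r ^ 2 / t * ((r * κ₁) ^ (2 * 1 + 1) + (r ^ 2) ^ 2 * κ₁ ^ (2 * 1 + 1)) ^ 2) : False := by
  subst ht
  have habs : 0 ≤ |c₀| := abs_nonneg c₀
  have hW : 0 < r ^ 6 * κ₁ ^ 6 := by positivity
  have hc' : r ^ 6 * κ₁ ^ 6 * (1 - r) ^ 2 ≤ r ^ 6 * κ₁ ^ 6 * (c₀ * (r ^ 2 * (1 + r) ^ 2)) := by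
    calc r ^ 6 * κ₁ ^ 6 * (1 - r) ^ 2 = (r ^ 2) ^ 2 * (r * κ₁ * κ₁) ^ (2 * 1) * (r * κ₁ - κ₁) ^ 2 := by ring
      _ ≤ c₀ * r ^ 2 / 1 * ((r * κ₁) ^ (2 * 1 + 1) + (r ^ 2) ^ 2 * κ₁ ^ (2 * 1 + 1)) ^ 2 := hc
      _ = r ^ 6 * κ₁ ^ 6 * (c₀ * (r ^ 2 * (1 + r) ^ 2)) := by ring
  have hc2 : (1 - r) ^ 2 ≤ c₀ * (r ^ 2 * (1 + r) ^ 2) := le_of_mul_le_mul_left hc' hW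
  have hr32 : r ≤ 1 / 32 := by nlinarith
  have h1 : c₀ * (r ^ 2 * (1 + r) ^ 2) ≤ |c₀| * (r ^ 2 * (1 + r) ^ 2) :=
    mul_le_mul_of_nonneg_right (le_abs_self c₀) (by positivity)
  have h2 : |c₀| * r ≤ 1 / 32 := by nlinarith
  have h3 : |c₀| * (r ^ 2 * (1 + r) ^ 2) ≤ 1 / 32 * (r * (1 + r) ^ 2) := by
    have : |c₀| * (r ^ 2 * (1 + r) ^ 2) = (|c₀| * r) * (r * (1 + r) ^ 2) := by ring
    rw [this]
    exact mul_le_mul_of_nonneg_right h2 (by positivity)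
  have h4 : r * (1 + r) ^ 2 ≤ 1 / 32 * (33 / 32) ^ 2 := by
    have : (1 + r) ^ 2 ≤ (33 / 32) ^ 2 := pow_le_pow_left₀ (by positivity) (by linarith) 2
    calc r * (1 + r) ^ 2 ≤ 1 / 32 * (1 + r) ^ 2 := mul_le_mul_of_nonneg_right hr32 (by positivity)
      _ ≤ 1 / 32 * (33 / 32) ^ 2 := mul_le_mul_of_nonneg_left this (by norm_num)
  have h5 : (31 / 32 : ℝ) ^ 2 ≤ (1 - r) ^ 2 := pow_le_pow_left₀ (by norm_num) (by linarith) 2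
  nlinarith

end Arith

/-! ## §4 ★ (H1) is load-bearing: without the RAW block defect no constant gives the `1/ℓ²` contraction -/

section WithoutRaw

/-- ★ **`BlockToFine.defect_contraction` is FALSE without its raw-block-defect hypothesis (H1), for EVERY constant `c₀` in place of `600`.**
Witness: `L = 1`, `β = 1`, the downward atom `v = ψ₁ + 1•ψ₂` over a physical eigenpair with `0 < κ₂ ≤ κ₁/2`, block length `ℓ > 8|c₀| + 8`,
`δ := (κ₂^ℓ/κ₁^ℓ)²` (`≤ 1/64`): the dressed block defect (H2) holds, the fine defect equals `κ₁^{2ℓ}κ₂^{2ℓ}(κ₁−κ₂)² ≥ δ·κ₁^{4ℓ+2}/4`, whereas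
`c₀δ/ℓ²·⟨u,Ku⟩² ≤ 4c₀δκ₁^{4ℓ+2}/ℓ²`.  So the raw clause of a block stub cannot be dropped: dressed-only block data reach (o4) only with a constant `∝ ℓ² = L²`.
[folklore] -/
theorem defect_contraction_false_without_raw :
    ¬ ∃ c₀ : ℝ, ∀ (L : ℕ) [NeZero L] (β : ℝ), 0 < β → ∀ (v : GaugeConfig 3 L SU2 → ℝ), IsPhys v → ∀ (ℓ : ℕ), 1 ≤ ℓ →
      ∀ (δ : ℝ), 0 ≤ δ → δ ≤ 1 / 32 →
      l2 ((transferApply β)^[ℓ] v) ((transferApply β)^[2 * ℓ] ((transferApply β)^[ℓ] v)) *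
          l2 ((transferApply β)^[ℓ] v) ((transferApply β)^[ℓ] v) ≤
        (1 + δ) * l2 ((transferApply β)^[ℓ] v) ((transferApply β)^[ℓ] ((transferApply β)^[ℓ] v)) ^ 2 →
      l2 (transferApply β ((transferApply β)^[ℓ] v)) (transferApply β ((transferApply β)^[ℓ] v)) *
            l2 ((transferApply β)^[ℓ] v) ((transferApply β)^[ℓ] v) -
          l2 ((transferApply β)^[ℓ] v) (transferApply β ((transferApply β)^[ℓ] v)) ^ 2 ≤
        c₀ * δ / (ℓ : ℝ) ^ 2 * l2 ((transferApply β)^[ℓ] v) (transferApply β ((transferApply β)^[ℓ] v)) ^ 2 := by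
  rintro ⟨c₀, h⟩
  obtain ⟨ψ₁, ψ₂, κ₁, κ₂, h₁, h₂, hn₁, hn₂, h₁₂, he₁, he₂, hκ₁, hκ₂, hle⟩ :=
    exists_eigenpair_ratio_le (L := 1) (β := 1) one_pos (ρ := 1 / 2) (by norm_num) (by norm_num)
  obtain ⟨ℓ, hℓ⟩ := exists_nat_gt (8 * |c₀| + 8)
  have habs : 0 ≤ |c₀| := abs_nonneg c₀
  have hℓ1 : 1 ≤ ℓ := by
    have : (1 : ℝ) ≤ ℓ := by linarith
    exact_mod_cast this
  have hℓ3 : 3 ≤ ℓ := by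
    have : (3 : ℝ) ≤ ℓ := by linarith
    exact_mod_cast this
  have hκ₂le : κ₂ ≤ κ₁ / 2 := by linarith
  have hXpos : 0 < κ₁ ^ ℓ := pow_pos hκ₁ ℓ
  have hYpos : 0 < κ₂ ^ ℓ := pow_pos hκ₂ ℓ
  have hYX : κ₂ ^ ℓ ≤ κ₁ ^ ℓ := pow_le_pow_left₀ hκ₂.le (by linarith) ℓ
  have p2 : ∀ κ : ℝ, κ ^ (2 * ℓ) = (κ ^ ℓ) ^ 2 := fun κ => by rw [pow_mul']
  have p3 : ∀ κ : ℝ, κ ^ (ℓ + (ℓ + ℓ)) = (κ ^ ℓ) ^ 3 := fun κ => by rw [← pow_mul, show ℓ * 3 = ℓ + (ℓ + ℓ) by ring]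
  have p4 : ∀ κ : ℝ, κ ^ (ℓ + (2 * ℓ + ℓ)) = (κ ^ ℓ) ^ 4 := fun κ => by rw [← pow_mul, show ℓ * 4 = ℓ + (2 * ℓ + ℓ) by ring]
  -- (e1) ‖u‖², (e2) ⟨u,Ku⟩, (e3) ‖Ku‖², (e4) ⟨u,Pu⟩, (e5) ⟨u,P²u⟩ for u = K^ℓ(ψ₁ + 1•ψ₂)
  have e1 : l2 ((transferApply (1 : ℝ))^[ℓ] (ψ₁ + (1 : ℝ) • ψ₂)) ((transferApply 1)^[ℓ] (ψ₁ + (1 : ℝ) • ψ₂)) =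
      (κ₁ ^ ℓ) ^ 2 + (κ₂ ^ ℓ) ^ 2 := by
    rw [l2_dressedMixture_self 1 h₁ h₂ he₁ he₂ hn₁ hn₂ h₁₂, one_pow, one_mul, p2, p2]
  have e2 : l2 ((transferApply (1 : ℝ))^[ℓ] (ψ₁ + (1 : ℝ) • ψ₂)) (transferApply 1 ((transferApply 1)^[ℓ] (ψ₁ + (1 : ℝ) • ψ₂))) =
      (κ₁ ^ ℓ) ^ 2 * κ₁ + (κ₂ ^ ℓ) ^ 2 * κ₂ := by
    rw [l2_dressedMixture_transferApply 1 h₁ h₂ he₁ he₂ hn₁ hn₂ h₁₂, one_pow, one_mul, pow_succ, pow_succ, p2, p2]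
  have e3 : l2 (transferApply 1 ((transferApply (1 : ℝ))^[ℓ] (ψ₁ + (1 : ℝ) • ψ₂)))
      (transferApply 1 ((transferApply 1)^[ℓ] (ψ₁ + (1 : ℝ) • ψ₂))) = (κ₁ ^ ℓ) ^ 2 * κ₁ ^ 2 + (κ₂ ^ ℓ) ^ 2 * κ₂ ^ 2 := by
    rw [l2_transferApply_dressedMixture_self 1 h₁ h₂ he₁ he₂ hn₁ hn₂ h₁₂, one_pow, one_mul, pow_add, pow_add, p2, p2]
  have e4 : l2 ((transferApply (1 : ℝ))^[ℓ] (ψ₁ + (1 : ℝ) • ψ₂)) ((transferApply 1)^[ℓ] ((transferApply 1)^[ℓ] (ψ₁ + (1 : ℝ) • ψ₂))) =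
      (κ₁ ^ ℓ) ^ 3 + (κ₂ ^ ℓ) ^ 3 := by
    rw [← Function.iterate_add_apply, l2_mixture_iterate_iterate 1 h₁ h₂ he₁ he₂ hn₁ hn₂ h₁₂, one_pow, one_mul, p3, p3]
  have e5 : l2 ((transferApply (1 : ℝ))^[ℓ] (ψ₁ + (1 : ℝ) • ψ₂)) ((transferApply 1)^[2 * ℓ] ((transferApply 1)^[ℓ] (ψ₁ + (1 : ℝ) • ψ₂))) =
      (κ₁ ^ ℓ) ^ 4 + (κ₂ ^ ℓ) ^ 4 := by
    rw [← Function.iterate_add_apply, l2_mixture_iterate_iterate 1 h₁ h₂ he₁ he₂ hn₁ hn₂ h₁₂, one_pow, one_mul, p4, p4]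
  -- the dressed block defect (H2) with δ := (κ₂^ℓ/κ₁^ℓ)² ≤ 1/64
  have hq0 : 0 ≤ κ₂ ^ ℓ / κ₁ ^ ℓ := div_nonneg hYpos.le hXpos.le
  have hq : κ₂ ^ ℓ / κ₁ ^ ℓ ≤ 1 / 8 := by
    rw [← div_pow]
    calc (κ₂ / κ₁) ^ ℓ ≤ (1 / 2) ^ ℓ := pow_le_pow_left₀ (div_nonneg hκ₂.le hκ₁.le) (by rw [div_le_iff₀ hκ₁]; linarith) ℓ
      _ ≤ (1 / 2) ^ 3 := pow_le_pow_of_le_one (by norm_num) (by norm_num) hℓ3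
      _ = 1 / 8 := by norm_num
  have hδ0 : 0 ≤ (κ₂ ^ ℓ / κ₁ ^ ℓ) ^ 2 := sq_nonneg _
  have hδ : (κ₂ ^ ℓ / κ₁ ^ ℓ) ^ 2 ≤ 1 / 32 :=
    calc (κ₂ ^ ℓ / κ₁ ^ ℓ) ^ 2 ≤ (1 / 8) ^ 2 := pow_le_pow_left₀ hq0 hq 2
      _ ≤ 1 / 32 := by norm_num
  have hdress : l2 ((transferApply (1 : ℝ))^[ℓ] (ψ₁ + (1 : ℝ) • ψ₂)) ((transferApply 1)^[2 * ℓ] ((transferApply 1)^[ℓ] (ψ₁ + (1 : ℝ) • ψ₂))) *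
        l2 ((transferApply 1)^[ℓ] (ψ₁ + (1 : ℝ) • ψ₂)) ((transferApply 1)^[ℓ] (ψ₁ + (1 : ℝ) • ψ₂)) ≤
      (1 + (κ₂ ^ ℓ / κ₁ ^ ℓ) ^ 2) *
        l2 ((transferApply 1)^[ℓ] (ψ₁ + (1 : ℝ) • ψ₂)) ((transferApply 1)^[ℓ] ((transferApply 1)^[ℓ] (ψ₁ + (1 : ℝ) • ψ₂))) ^ 2 := by
    rw [e5, e1, e4]
    exact dressedBlockDefect_downwardAtom hXpos hYpos hYX
  have hc := h 1 1 one_pos (ψ₁ + (1 : ℝ) • ψ₂) (h₁.add (h₂.smul 1)) ℓ hℓ1 ((κ₂ ^ ℓ / κ₁ ^ ℓ) ^ 2) hδ0 hδ hdress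
  rw [e3, e1, e2] at hc
  exact downwardAtom_contra hκ₁ hκ₂ hκ₂le hXpos hYpos hYX hℓ hc

end WithoutRaw

/-! ## §5 ★ (H2) is load-bearing: without the DRESSED block defect no constant works, already at `ℓ = 1` -/

section WithoutDressed

/-- ★ **`BlockToFine.defect_contraction` is FALSE without its dressed-block-defect hypothesis (H2), for EVERY constant `c₀` in place of `600`,
already at block length `ℓ = 1`.**  Witness: `L = 1`, `β = 1`, the upward atom `v = ψ₂ + r²•ψ₁` over a physical eigenpair with `κ₂ = rκ₁`,
`0 < r ≤ 1/(32(|c₀|+1))`, `δ := r²`: the raw block defect (H1) holds (`(1+r²)(1+r⁴) ≤ (1+r²)(1+r³)²`), the fine defect of `u = Kv` equals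
`r⁶κ₁⁶(1−r)²`, whereas `c₀δ·⟨u,Ku⟩² = c₀r⁸κ₁⁶(1+r)²`.  So the dressed clause of a block stub cannot be dropped either (card «block-endpoint», falsifier F2).
[folklore] -/
theorem defect_contraction_false_without_dressed :
    ¬ ∃ c₀ : ℝ, ∀ (L : ℕ) [NeZero L] (β : ℝ), 0 < β → ∀ (v : GaugeConfig 3 L SU2 → ℝ), IsPhys v → ∀ (ℓ : ℕ), 1 ≤ ℓ →
      ∀ (δ : ℝ), 0 ≤ δ → δ ≤ 1 / 32 →
      l2 v ((transferApply β)^[2 * ℓ] v) * l2 v v ≤ (1 + δ) * l2 v ((transferApply β)^[ℓ] v) ^ 2 →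
      l2 (transferApply β ((transferApply β)^[ℓ] v)) (transferApply β ((transferApply β)^[ℓ] v)) *
            l2 ((transferApply β)^[ℓ] v) ((transferApply β)^[ℓ] v) -
          l2 ((transferApply β)^[ℓ] v) (transferApply β ((transferApply β)^[ℓ] v)) ^ 2 ≤
        c₀ * δ / (ℓ : ℝ) ^ 2 * l2 ((transferApply β)^[ℓ] v) (transferApply β ((transferApply β)^[ℓ] v)) ^ 2 := by
  rintro ⟨c₀, h⟩
  have habs : 0 ≤ |c₀| := abs_nonneg c₀
  have hρ : (0 : ℝ) < 1 / (32 * (|c₀| + 1)) := by positivity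
  have hρ1 : 1 / (32 * (|c₀| + 1)) < 1 := by
    rw [div_lt_one (by positivity)]; nlinarith
  obtain ⟨ψ₁, ψ₂, κ₁, κ₂, h₁, h₂, hn₁, hn₂, h₁₂, he₁, he₂, hκ₁, hκ₂, hle⟩ :=
    exists_eigenpair_ratio_le (L := 1) (β := 1) one_pos hρ hρ1
  have h₂₁ : l2 ψ₂ ψ₁ = 0 := by rw [l2_comm]; exact h₁₂
  -- κ₂ = rκ₁ with 0 < r, r(|c₀|+1) ≤ 1/32
  obtain ⟨r, hr, rfl⟩ : ∃ r : ℝ, 0 < r ∧ κ₂ = r * κ₁ := ⟨κ₂ / κ₁, div_pos hκ₂ hκ₁, (div_mul_cancel₀ κ₂ hκ₁.ne').symm⟩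
  have hrle : r ≤ 1 / (32 * (|c₀| + 1)) := le_of_mul_le_mul_right hle hκ₁
  have hrc : r * (|c₀| + 1) ≤ 1 / 32 := by
    rw [le_div_iff₀ (by positivity)] at hrle
    linarith
  have hr1 : r ≤ 1 := by nlinarith
  have hδ0 : 0 ≤ r ^ 2 := sq_nonneg r
  have hδ : r ^ 2 ≤ 1 / 32 := by nlinarith
  -- the raw block defect (H1) of the upward atom v = ψ₂ + r²•ψ₁ at ℓ = 1, δ := r²
  have hraw : l2 (ψ₂ + (r ^ 2) • ψ₁) ((transferApply (1 : ℝ))^[2 * 1] (ψ₂ + (r ^ 2) • ψ₁)) * l2 (ψ₂ + (r ^ 2) • ψ₁) (ψ₂ + (r ^ 2) • ψ₁) ≤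
      (1 + r ^ 2) * l2 (ψ₂ + (r ^ 2) • ψ₁) ((transferApply (1 : ℝ))^[1] (ψ₂ + (r ^ 2) • ψ₁)) ^ 2 := by
    rw [l2_mixture_self_iterate 1 h₂ h₁ he₂ he₁ hn₂ hn₁ h₂₁ (r ^ 2) (2 * 1),
      l2_weightedMixture_self (L := 1) 1 h₂ h₁ he₂ he₁ hn₂ hn₁ h₂₁ (r ^ 2),
      l2_mixture_self_iterate 1 h₂ h₁ he₂ he₁ hn₂ hn₁ h₂₁ (r ^ 2) 1]
    exact rawBlockDefect_upwardAtom hκ₁ hr hr1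
  have hc := h 1 1 one_pos (ψ₂ + (r ^ 2) • ψ₁) (h₂.add (h₁.smul _)) 1 le_rfl (r ^ 2) hδ0 hδ hraw
  rw [leakage_defect_of_dressedMixture 1 h₂ h₁ he₂ he₁ hn₂ hn₁ h₂₁ (r ^ 2) 1,
    l2_dressedMixture_transferApply 1 h₂ h₁ he₂ he₁ hn₂ hn₁ h₂₁ (r ^ 2) 1] at hc
  exact upwardAtom_contra hκ₁ hr hrc _ (by norm_num) hc

end WithoutDressed

end Summit.QuantumFields.YangMills.Theorems.FemtoTransferGap.PolyakovLift.Negative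

end
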